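import Summits.HodgeConjecture.HodgeConjecture.Theses.NodalThetaWeil
import Summits.HodgeConjecture.HodgeConjecture.Theorems.LimitExtensionDivisorInduction
import Literature.AlgebraicGeometry.HodgeTheory.LefschetzOneOneHolds

/-!
# Route NodalThetaWeil — `FourfoldSupportedClassesAlgebraic` (support item stmt-HodgeConjecture-7747)

On a smooth projective complex fourfold, a rational `(2,2)`-class supported on a divisor
(`c ∈ N¹H⁴ = supportedClasses X 4 1`) is algebraic: the case `(n, p) = (3, 2)` of the tree's
UNCONDITIONAL divisor induction `limitExtension_divisorInduction_proof` (item stmt-HodgeConjecture-1082: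
log resolution of the supporting divisor, Deligne's principle of two types for snc boundaries —
discharged, `Deligne1974_ker_pullback_eq_ker_pullback_snc_holds` —, Voisin's lift of Hodge classes along
the Gysin surjection, push-forward), fed with the Lefschetz theorem on `(1,1)`-classes on the resolved
threefold components (`lefschetzOneOne_rational_holds`, discharged).  No named-fact hypothesis, no sorry.
-/

-- `Summit.HodgeConjecture.HodgeConjecture.Theorems` is the mandated namespace (single-problem
-- summit: Problem = Summit), which `linter.dupNamespace` flags on every declaration; the lakefile
-- turns the linter off tree-wide (weak option), restated here so stand-alone elaboration is
-- warning-free too.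
set_option linter.dupNamespace false

namespace Summit.HodgeConjecture.HodgeConjecture.Theorems

open Literature.AlgebraicGeometry.HodgeTheory

/-- **Item stmt-HodgeConjecture-7747 (`FourfoldSupportedClassesAlgebraic`), route `NodalThetaWeil`**:
divisor-supported rational `(2,2)`-classes on smooth projective fourfolds are algebraic — divisor
induction at `(n, p) = (3, 2)` (`limitExtension_divisorInduction_proof`) with Lefschetz `(1,1)` on
threefolds (`lefschetzOneOne_rational_holds`). [cite: DeligneHodgeIII1974, Prop. 8.2.7 and Cor. 8.2.8]
[cite: VoisinHodgeI2002, Thm. 11.30] -/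
theorem nodalThetaWeil_fourfoldSupportedClassesAlgebraic_proof :
    Summit.HodgeConjecture.HodgeConjecture.Theses.NodalThetaWeil.FourfoldSupportedClassesAlgebraic := by
  intro X hX c hc hpp hN
  exact limitExtension_divisorInduction_proof 3 2 one_le_two
    (fun _Y hY a ha haa ↦ lefschetzOneOne_rational_holds hY a ha haa) hX c hc hpp hN

end Summit.HodgeConjecture.HodgeConjecture.Theorems
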